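import Literature.Computability.Cryptography.TreeSigLazy
import Literature.Computability.Cryptography.TreeSigSingleUse
import Literature.Computability.Cryptography.CoinBlockBirthday
import HarnessLib

/-!
# The authentication-tree scheme, X: the hybrid identity of the one-time reduction

Topic `Literature/Computability/Cryptography`; continues `TreeSigLazy.lean` (the ideal PRF game of the distinguisher
as an average over its coins `r` and a uniform SUPPLY of node blocks, of the forgery event against the signer over
the block assignment `TabL`) and `TreeSigSingleUse.lean` (a planted node is used once). This file is the
probability-free-but-averaging heart of Goldreich's reduction (proof of Prop. 6.4.15, Steps 1–3, in the lazy form of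
Prop. 6.4.17): planting an EXTERNAL one-time instance at the node of slot `t` does not change the distribution of
the emulated attack —

* the block of the planted label is one uniform supply block, independent of everything else (`TabW_eq_update`,
  re-randomisation `uniformAvg_rerand`);
* a uniform block `c‖u` IS a uniform key-generation coin string `c` and uniform signing coins: the planted node's
  signer `m ↦ S_{sk_c}(m; fitLen u ℓ)` is used on ONE message (`run_update_eq` of `TreeSigSingleUse.lean`), and on one
  message `fitLen u ℓ` for uniform `u ∈ {0,1}^{CS(n)}` induces the same signature distribution as uniform coins of the
  exact length `ℓ` when the signer reads at most `CS(n)` coins (`Spec.HCS`, `uniformAvg_sign_fitLen`).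

Contents: the averaging toolkit (`uniformAvg_comm'`, `uniformAvg_append'`, `uniformAvg_rerand`,
`uniformAvg_sign_fitLen`), supplies as bit strings (`TabW`, `TabL_ofFn_vblocks`, `supplyProb_eq_uniformAvg`).

All statements proved; no named facts.

## References

* O. Goldreich, *Foundations of Cryptography II*, CUP 2004, §6.4.2.2–6.4.2.3, proof of Prop. 6.4.15 (Steps 1–4) and
  Prop. 6.4.17 ("both the key-generation and signing algorithms use exactly `n` internal coin tosses", justified by
  pseudorandom generators — here: the signer reads at most `CS(n)` coins, hypothesis `Spec.HCS`).
* O. Goldreich, *Foundations of Cryptography I*, CUP 2001, Thm. 3.6.6 (proof, Claim 3.6.6.1).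
-/

namespace Literature.Computability.Cryptography

open _root_.Computability Complexity Complexity.Brick Polynomial Finset
open Complexity.OracleAlg Complexity.LazyTable

namespace TreeSig

/-! ### Averaging toolkit -/

/-- **Fubini for uniform averages** (local copy of `HybridSampling.uniformAvg_comm`, a file downstream in content).
[folklore] -/
theorem uniformAvg_comm' (a b : ℕ) (φ : List Bool → List Bool → ℝ) :
    uniformAvg a (fun u => uniformAvg b fun w => φ u w) = uniformAvg b (fun w => uniformAvg a fun u => φ u w) := by
  unfold uniformAvg
  simp only [Finset.sum_div]
  rw [Finset.sum_comm]
  refine Finset.sum_congr rfl fun w _ => Finset.sum_congr rfl fun u _ => ?_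
  rw [div_div, div_div, mul_comm]

/-- Splitting a uniform average as prefix and suffix (local copy of `HybridSampling.uniformAvg_append`). [folklore] -/
theorem uniformAvg_append' (a b : ℕ) (F : List Bool → ℝ) :
    uniformAvg (a + b) F = uniformAvg a fun u => uniformAvg b fun w => F (u ++ w) := by
  rw [← SigOWF.uniformAvg_add' a b fun u w => F (u ++ w)]
  exact SigOWF.uniformAvg_congr' fun x _ => by rw [List.take_append_drop]

/-- **Re-randomising one block.** If `Ψ w v` does not depend on block `j` of `w` (`Ψ (ins R j x w) v = Ψ w v`), then
averaging `Ψ w (blk R j w)` over uniform `w ∈ {0,1}^{mR}` (`j < m`) is averaging `Ψ w v` over `w` and an INDEPENDENT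
uniform block `v`. [Goldreich 2004, proof of Prop. 6.4.15, Step 2 (the planted instance is distributed as a generated
one)] [folklore] -/
theorem uniformAvg_rerand {R m j : ℕ} (hj : j < m) (Ψ : List Bool → List Bool → ℝ)
    (hΨ : ∀ (w x v : List Bool), w.length = m * R → x.length = R → Ψ (Yao.ins R j x w) v = Ψ w v) :
    uniformAvg (m * R) (fun w => Ψ w (Yao.blk R j w)) = uniformAvg (m * R) fun w => uniformAvg R fun v => Ψ w v := by
  -- split `w = w₁ ‖ v ‖ w₂`
  have hsplit : m * R = j * R + (R + (m - j - 1) * R) := by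
    have : m = j + (1 + (m - j - 1)) := by omega
    conv_lhs => rw [this]
    ring
  rw [hsplit, uniformAvg_append', uniformAvg_append']
  refine SigOWF.uniformAvg_congr' fun w₁ hw₁ => ?_
  rw [uniformAvg_append', uniformAvg_append']
  have hblk : ∀ v w₂ : List Bool, v.length = R → Yao.blk R j (w₁ ++ (v ++ w₂)) = v := by
    intro v w₂ hv
    rw [Yao.blk_eq_take_drop, List.drop_append_of_le_length (by rw [hw₁]), List.drop_eq_nil_of_le (by rw [hw₁]), List.nil_append,
      List.take_append_of_le_length hv.ge, List.take_of_length_le hv.le]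
  have hins : ∀ (v x w₂ : List Bool), v.length = R → x.length = R →
      Yao.ins R j x (w₁ ++ (v ++ w₂)) = w₁ ++ (x ++ w₂) := by
    intro v x w₂ hv _
    have hd : (w₁ ++ (v ++ w₂)).drop (j * R + R) = w₂ := by
      rw [← List.append_assoc]; exact List.drop_left' (by simp [hw₁, hv])
    rw [Yao.ins, List.take_left' hw₁, hd, List.append_assoc]
  -- LHS: `avg_v avg_{w₂} Ψ (w₁ v w₂) v`; erase `v` from the first argument using a fixed block
  have hL : uniformAvg R (fun v => uniformAvg ((m - j - 1) * R) fun w₂ => Ψ (w₁ ++ (v ++ w₂)) (Yao.blk R j (w₁ ++ (v ++ w₂)))) =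
      uniformAvg R (fun v => uniformAvg ((m - j - 1) * R) fun w₂ => Ψ (w₁ ++ (List.replicate R false ++ w₂)) v) := by
    refine SigOWF.uniformAvg_congr' fun v hv => SigOWF.uniformAvg_congr' fun w₂ hw₂ => ?_
    rw [hblk v w₂ hv, ← hins v (List.replicate R false) w₂ hv (by simp),
      hΨ _ _ _ (by simp [hw₁, hv, hw₂]; rw [hsplit]) (by simp)]
  have hR : uniformAvg R (fun v' => uniformAvg ((m - j - 1) * R) fun w₂ => uniformAvg R fun v => Ψ (w₁ ++ (v' ++ w₂)) v) =
      uniformAvg R (fun _ => uniformAvg ((m - j - 1) * R) fun w₂ => uniformAvg R fun v => Ψ (w₁ ++ (List.replicate R false ++ w₂)) v) := by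
    refine SigOWF.uniformAvg_congr' fun v' hv' => SigOWF.uniformAvg_congr' fun w₂ hw₂ => SigOWF.uniformAvg_congr' fun v _ => ?_
    rw [← hins v' (List.replicate R false) w₂ hv' (by simp), hΨ _ _ _ (by simp [hw₁, hv', hw₂]; rw [hsplit]) (by simp)]
  rw [hL, hR, SigOWF.uniformAvg_const', uniformAvg_comm']

/-! ### The signer reads at most `CS(n)` coins -/

/-- **Hypothesis `HCS`**: under keys of `G(1ⁿ)`, the one-time signer reads at most the first `CS(n)` of its coins (its
output on coins `ρ` equals its output on `ρ ↾ CS(n)` padded back to length `|ρ|`). Goldreich assumes outright that the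
signer uses exactly `n` coins ("justified by using pseudorandom generators"); the hash-then-Lamport instance reads the
`cI(n)` coins of its hashing index. [Goldreich 2004, §6.4.2.3 (opening paragraph)] [cite: Goldreich2004, Construction 6.4.16] -/
def _root_.Literature.Computability.Cryptography.TreeSig.Spec.HCS (P : Spec) : Prop :=
  ∀ (n : ℕ) (c : List Bool), c.length = P.pG.eval n → ∀ (m ρ : List Bool),
    ρ.length = P.S.sign.coinLen (pairCode ((P.S.keyGen.run n c).2, m)).length →
    P.S.sign.run ((P.S.keyGen.run n c).2, m) ρ = P.S.sign.run ((P.S.keyGen.run n c).2, m) (fitLen (ρ.take (P.CS.eval n)) ρ.length)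

variable {P : Spec} {𝒜 : OracleAdversary (List Bool × List Bool)}

/-- `fitLen` of a long enough string is its prefix. [folklore] -/
theorem fitLen_of_le {u : List Bool} {ℓ : ℕ} (h : ℓ ≤ u.length) : fitLen u ℓ = u.take ℓ := by
  rw [fitLen, Nat.sub_eq_zero_of_le h, List.replicate_zero, List.append_nil]

/-- **The coin identity of the planted signer.** Under `HCS`, signing ONE message with coins `fitLen u ℓ` for a uniform
block part `u ∈ {0,1}^{CS(n)}` induces the same average of any statistic as uniform coins of the exact length `ℓ`.
[Goldreich 2004, proof of Prop. 6.4.15, Step 2 with §6.4.2.3] [folklore] -/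
theorem uniformAvg_sign_fitLen (hcs : P.HCS) (hW : P.WF) {n : ℕ} {c : List Bool} (hc : c.length = P.pG.eval n) (m : List Bool) (G : List Bool → ℝ) :
    uniformAvg (P.CS.eval n) (fun u => G (P.S.sign.run ((P.S.keyGen.run n c).2, m)
        (fitLen u (P.pS.eval (pairCode ((P.S.keyGen.run n c).2, m)).length)))) =
      uniformAvg (P.S.sign.coinLen (pairCode ((P.S.keyGen.run n c).2, m)).length) fun ρ => G (P.S.sign.run ((P.S.keyGen.run n c).2, m) ρ) := by
  set ℓ := P.S.sign.coinLen (pairCode ((P.S.keyGen.run n c).2, m)).length with hℓ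
  have hpS : P.pS.eval (pairCode ((P.S.keyGen.run n c).2, m)).length = ℓ := (hW.hcS _).symm
  rw [hpS]
  rcases le_or_gt ℓ (P.CS.eval n) with hle | hgt
  · -- short coins: `fitLen u ℓ = u ↾ ℓ`, the remaining bits average out
    obtain ⟨e, he⟩ : ∃ e, P.CS.eval n = ℓ + e := ⟨P.CS.eval n - ℓ, by omega⟩
    rw [he, ← SigOWF.uniformAvg_take' ℓ e fun ρ => G (P.S.sign.run ((P.S.keyGen.run n c).2, m) ρ)]
    refine SigOWF.uniformAvg_congr' fun u hu => ?_
    rw [fitLen_of_le (by omega)]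
  · -- long coins: only the first `CS(n)` matter (`HCS`), the rest average out on the right
    obtain ⟨e, he⟩ : ∃ e, ℓ = P.CS.eval n + e := ⟨ℓ - P.CS.eval n, by omega⟩
    have hrhs : uniformAvg ℓ (fun ρ => G (P.S.sign.run ((P.S.keyGen.run n c).2, m) ρ)) =
        uniformAvg (P.CS.eval n + e) (fun ρ => G (P.S.sign.run ((P.S.keyGen.run n c).2, m) (fitLen (ρ.take (P.CS.eval n)) ℓ))) := by
      rw [← he]
      refine SigOWF.uniformAvg_congr' fun ρ hρ => ?_
      rw [hcs n c hc m ρ (by rw [hρ]), hρ]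
    rw [hrhs, SigOWF.uniformAvg_take' (P.CS.eval n) e fun u => G (P.S.sign.run ((P.S.keyGen.run n c).2, m) (fitLen u ℓ))]

/-! ### Supplies as bit strings -/

variable (P 𝒜)

/-- **The block assignment read off a supply STRING** `w ∈ {0,1}^{m·R}` (block `j` = `blk R j w`): the block of the
label `L` is `ε` if its code is not a key, else the supply block at the first round fetching the same key (fitted to
length `R`, which only matters beyond the supply). [folklore] -/
noncomputable def TabW (n : ℕ) (r w : List Bool) (L : List Bool) : List Bool :=
  match (tspec n (P.R.eval n)).key (code n L) with
  | none => []
  | some κ => fitLen (Yao.blk (P.R.eval n) (fIdx κ (keysD P 𝒜 n r)) w) (P.R.eval n)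

/-- The supply vectors of a supply string. [folklore] -/
def vblocks (R m : ℕ) (w : List Bool) : Fin m → List.Vector Bool R := fun j => ⟨fitLen (Yao.blk R j w) R, length_fitLen _ _⟩

variable {P 𝒜}

/-- The default vector is the all-zero string. [folklore] -/
theorem toList_default_vector (R : ℕ) : (default : List.Vector Bool R).toList = List.replicate R false := by
  show (List.Vector.ofFn fun _ : Fin R => (default : Bool)).toList = _
  rw [List.Vector.toList_ofFn]
  exact List.ofFn_const R false

/-- `TabL` over the supply vectors of a string is `TabW`. [folklore] -/
theorem TabL_ofFn_vblocks (n m : ℕ) (r w : List Bool) (hw : w.length = m * P.R.eval n) :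
    TabL P 𝒜 n r (List.ofFn (vblocks (P.R.eval n) m w)) = TabW P 𝒜 n r w := by
  funext L
  simp only [TabL, TabW]
  cases (tspec n (P.R.eval n)).key (code n L) with
  | none => rfl
  | some κ =>
    dsimp only
    set j := fIdx κ (keysD P 𝒜 n r)
    rw [List.getI_eq_getElem?_getD, List.getElem?_ofFn]
    by_cases hj : j < m
    · simp [hj, vblocks]
    · simp only [hj, dite_false, Option.getD_none]
      have hblk : Yao.blk (P.R.eval n) j w = [] := by
        rw [Yao.blk_eq_take_drop, List.drop_eq_nil_of_le (by rw [hw]; exact Nat.mul_le_mul_right _ (not_lt.1 hj)), List.take_nil]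
      rw [hblk, fitLen, toList_default_vector]
      simp

/-! ### Supplies: counting over vectors is averaging over strings -/

/-- The blocks of a concatenation of blocks. [folklore] -/
theorem blk_flatten_ofFn {R : ℕ} : ∀ (m : ℕ) (s : Fin m → List.Vector Bool R) (j : Fin m),
    Yao.blk R j (List.ofFn fun i => (s i).toList).flatten = (s j).toList
  | 0, _, j => j.elim0
  | m + 1, s, j => by
    rw [List.ofFn_succ, List.flatten_cons]
    cases j using Fin.cases with
    | zero =>
      rw [Fin.val_zero, Yao.blk_zero, List.take_left' (by simp)]
    | succ j =>
      rw [Fin.val_succ, Yao.blk_succ, List.drop_left' (by simp)]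
      exact blk_flatten_ofFn m (fun i => s i.succ) j

/-- The concatenation of the blocks of a string is the string. [folklore] -/
theorem flatten_ofFn_blk {R : ℕ} : ∀ (m : ℕ) (w : List Bool), w.length = m * R →
    (List.ofFn fun j : Fin m => fitLen (Yao.blk R j w) R).flatten = w
  | 0, w, hw => by
    rw [Nat.zero_mul, List.length_eq_zero_iff] at hw
    subst hw; rfl
  | m + 1, w, hw => by
    rw [List.ofFn_succ, List.flatten_cons, Fin.val_zero, Yao.blk_zero]
    have hR : R ≤ w.length := by rw [hw]; nlinarith
    have htake : fitLen (w.take R) R = w.take R := by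
      rw [fitLen_of_le (by rw [List.length_take]; omega), List.take_take, min_self]
    have ih := flatten_ofFn_blk (R := R) m (w.drop R) (by rw [List.length_drop, hw, Nat.add_mul, one_mul, Nat.add_sub_cancel])
    have hfun : (fun i : Fin m => fitLen (Yao.blk R (Fin.succ i : Fin (m + 1)) w) R) = fun j : Fin m => fitLen (Yao.blk R j (w.drop R)) R := by
      funext i; rw [Fin.val_succ, Yao.blk_succ]
    rw [htake, hfun, ih, List.take_append_drop]

/-- **Supply strings and supply vectors correspond bijectively.** [folklore] -/
noncomputable def vblocksEquiv (R m : ℕ) : List.Vector Bool (m * R) ≃ (Fin m → List.Vector Bool R) where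
  toFun v := vblocks R m v.toList
  invFun s := ⟨(List.ofFn fun j => (s j).toList).flatten, by
    rw [List.length_flatten, List.map_ofFn, List.sum_ofFn]
    simp [Finset.sum_const, Finset.card_univ, Fintype.card_fin]⟩
  left_inv v := by
    apply List.Vector.toList_injective
    exact flatten_ofFn_blk m v.toList v.toList_length
  right_inv s := by
    funext j
    apply List.Vector.toList_injective
    show fitLen (Yao.blk R j (List.ofFn fun i => (s i).toList).flatten) R = (s j).toList
    rw [blk_flatten_ofFn m s j, fitLen_of_le (by simp), List.take_of_length_le (by simp)]

/-- **Counting over uniform supplies is averaging over uniform supply strings.** [folklore] -/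
theorem supplyProb_eq_uniformAvg {m R : ℕ} (E : (Fin m → List.Vector Bool R) → Prop) [DecidablePred E] :
    supplyProb E = uniformAvg (m * R) fun w => if E (vblocks R m w) then 1 else 0 := by
  classical
  rw [supplyProb, SigOWF.uniformAvg_indicator_eq_card]
  have hcard : (Fintype.card (Fin m → List.Vector Bool R) : ℝ) = 2 ^ (m * R) := by
    rw [Fintype.card_fun, Fintype.card_fin, card_vector, Fintype.card_bool, ← pow_mul, mul_comm]
    push_cast; rfl
  rw [hcard]
  congr 2
  symm
  exact Finset.card_equiv (vblocksEquiv R m) fun v => by simp [vblocksEquiv]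

/-! ### Slots: touched labels are fetched labels -/

/-- The number of slots: the root and the `2n` labels along each of the `T` query paths. [Goldreich 2004, proof of
Prop. 6.4.15, Step 1 ("A uniformly selects `j ∈ {1, …, (2n+1)·t}`")] [folklore] -/
def NSlot (n T : ℕ) : ℕ := 1 + 2 * n * T

/-- **A touched label is the label of a slot.** [Goldreich 2004, proof of Prop. 6.4.15, Step 1] [folklore] -/
theorem exists_slot_of_touched {n Q T : ℕ} (hQ : Q ≤ T) {ρ : List Bool} (hρ : T * n ≤ ρ.length) {L : List Bool} (h : Touched n Q ρ L) :
    ∃ t < NSlot n T, labAt n ρ t = L := by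
  rcases h with rfl | ⟨i, hi, hL⟩
  · exact ⟨0, by simp [NSlot], labAt_zero n ρ⟩
  · have hiT : i < T := lt_of_lt_of_le hi hQ
    have hσ : (i + 1) * n ≤ ρ.length := le_trans (Nat.mul_le_mul_right n (Nat.succ_le_of_lt hiT)) hρ
    obtain ⟨t, ht, rfl⟩ := List.getElem_of_mem hL
    have htn : t < 2 * n := by rw [length_pathLabels, Yao.length_blk_of_le hσ] at ht; exact ht
    refine ⟨pos n i ((pathLabels (Yao.blk n i ρ))[t]), pos_lt_of_mem n i hiT _ (Yao.length_blk_of_le hσ) (Or.inr (List.getElem_mem _)), ?_⟩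
    rw [pos_getElem_pathLabels n i _ t ht, labAt_pos n i ρ hσ t htn]

/-! ### The slot event -/

variable (P 𝒜)

/-- **The slot event** `EVT L`: in the indexed attack against the node interface `(pkN, sgN)` (leaves `ρ`, forger's
coins `rA`), the forger outputs `(α, sig)` whose claimed path passes through `L`, and the component at the level of `L`
is a valid one-time signature under `pkN L` on a message `L` never signed. [Goldreich 2004, proof of Prop. 6.4.15,
Step 4] [folklore] -/
def EVT (n : ℕ) (pkN : List Bool → List Bool) (sgN : List Bool → List Bool → List Bool) (ρ rA L : List Bool) : Prop :=
  ∃ α sig, 𝒜.alg.runIdx (OFunI n pkN sgN ρ) (TA P 𝒜 n) (boolPair (xA P n (pkN [])) rA) = some (α, sig) ∧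
    (fstF sig).take L.length = L ∧
    P.S.verify (pkN L) (compAt n α (sndF sig) L.length).1 (compAt n α (sndF sig) L.length).2 = true ∧
    ∀ m, SignedMsgs n pkN ρ (𝒜.alg.queriesIdx (OFunI n pkN sgN ρ) (TA P 𝒜 n) (boolPair (xA P n (pkN [])) rA)) L m →
      m ≠ (compAt n α (sndF sig) L.length).1

variable {P 𝒜}

/-- `EVT` only depends on the signer through the run and the transcript. [folklore] -/
theorem EVT_congr {n : ℕ} (pkN : List Bool → List Bool) {sgN sgN' : List Bool → List Bool → List Bool} {ρ rA : List Bool}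
    (hrun : 𝒜.alg.runIdx (OFunI n pkN sgN ρ) (TA P 𝒜 n) (boolPair (xA P n (pkN [])) rA) =
      𝒜.alg.runIdx (OFunI n pkN sgN' ρ) (TA P 𝒜 n) (boolPair (xA P n (pkN [])) rA))
    (hq : 𝒜.alg.queriesIdx (OFunI n pkN sgN ρ) (TA P 𝒜 n) (boolPair (xA P n (pkN [])) rA) =
      𝒜.alg.queriesIdx (OFunI n pkN sgN' ρ) (TA P 𝒜 n) (boolPair (xA P n (pkN [])) rA)) (L : List Bool) :
    EVT P 𝒜 n pkN sgN ρ rA L ↔ EVT P 𝒜 n pkN sgN' ρ rA L := by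
  unfold EVT
  rw [hrun, hq]

/-- **The slot decomposition of the forgery event**: a forgery yields the slot event at some slot.
[Goldreich 2004, proof of Prop. 6.4.15, Steps 1 and 4] [folklore] -/
theorem exists_slot_EVT_of_forgeWith {n : ℕ} (pkN : List Bool → List Bool) (sgN : List Bool → List Bool → List Bool) {ρ : List Bool}
    (hρ : TA P 𝒜 n * n ≤ ρ.length) (rA : List Bool) (h : ForgeWith P 𝒜 n (pkN []) (OFunI n pkN sgN ρ) rA) :
    ∃ t < NSlot n (TA P 𝒜 n), EVT P 𝒜 n pkN sgN ρ rA (labAt n ρ t) := by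
  obtain ⟨α, sig, hout, hσ, lvl, hlvl, htouch, hver, hfresh⟩ := exists_oneTime_forgeryI_of_forgeWith 𝒜 pkN sgN ρ rA hρ h
  obtain ⟨t, ht, hlab⟩ := exists_slot_of_touched (OracleAlg.length_queriesIdx_le _ _ _ _) hρ htouch
  have hlen : ((fstF sig).take lvl).length = lvl := by rw [List.length_take, hσ, min_eq_left hlvl]
  refine ⟨t, ht, α, sig, hout, ?_, ?_, ?_⟩
  · rw [hlab, hlen]
  · rw [hlab, hlen]; exact hver
  · rw [hlab, hlen]; exact hfresh

/-- The indicator form of the slot decomposition. [folklore] -/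
theorem indicator_forgeWith_le_sum {n : ℕ} (pkN : List Bool → List Bool) (sgN : List Bool → List Bool → List Bool) {ρ : List Bool}
    (hρ : TA P 𝒜 n * n ≤ ρ.length) (rA : List Bool) [Decidable (ForgeWith P 𝒜 n (pkN []) (OFunI n pkN sgN ρ) rA)]
    [∀ t, Decidable (EVT P 𝒜 n pkN sgN ρ rA (labAt n ρ t))] :
    (if ForgeWith P 𝒜 n (pkN []) (OFunI n pkN sgN ρ) rA then (1 : ℝ) else 0) ≤
      ∑ t ∈ Finset.range (NSlot n (TA P 𝒜 n)), if EVT P 𝒜 n pkN sgN ρ rA (labAt n ρ t) then (1 : ℝ) else 0 := by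
  split_ifs with h
  · obtain ⟨t, ht, hE⟩ := exists_slot_EVT_of_forgeWith pkN sgN hρ rA h
    have := Finset.single_le_sum (f := fun t => if EVT P 𝒜 n pkN sgN ρ rA (labAt n ρ t) then (1 : ℝ) else 0)
      (fun t _ => by positivity) (Finset.mem_range.2 ht)
    rwa [if_pos hE] at this
  · exact Finset.sum_nonneg fun t _ => by positivity

/-! ### Indicators -/

/-- The indicator of a proposition (classical; insensitive to decidability instances). [folklore] -/
noncomputable def ind (p : Prop) : ℝ := by classical exact if p then 1 else 0

/-- `ind` is the `if` for any instance. [folklore] -/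
theorem ind_eq_ite (p : Prop) [Decidable p] : ind p = if p then 1 else 0 := by
  unfold ind; split_ifs <;> rfl

/-- `ind_true` (bookkeeping). [folklore] -/
@[simp] theorem ind_true {p : Prop} (h : p) : ind p = 1 := by classical rw [ind_eq_ite, if_pos h]

/-- `ind_false` (bookkeeping). [folklore] -/
@[simp] theorem ind_false {p : Prop} (h : ¬ p) : ind p = 0 := by classical rw [ind_eq_ite, if_neg h]

/-- `ind_congr` (bookkeeping). [folklore] -/
theorem ind_congr {p q : Prop} (h : p ↔ q) : ind p = ind q := by rw [show p = q from propext h]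

/-- `ind_nonneg` (bookkeeping). [folklore] -/
theorem ind_nonneg (p : Prop) : 0 ≤ ind p := by classical rw [ind_eq_ite]; split_ifs <;> norm_num

/-- `ind_le_one` (bookkeeping). [folklore] -/
theorem ind_le_one (p : Prop) : ind p ≤ 1 := by classical rw [ind_eq_ite]; split_ifs <;> norm_num

/-- `ind_and_of_left` (bookkeeping). [folklore] -/
theorem ind_and_of_left {p q : Prop} (h : ¬ q) : ind (p ∧ q) = 0 := ind_false fun hpq => h hpq.2

/-! ### First occurrences, continued -/

section FIdx

variable {K : Type} [DecidableEq K]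

/-- The first occurrence is within the list. [folklore] -/
theorem fIdx_le_length (κ : K) : ∀ ks : List (Option K), fIdx κ ks ≤ ks.length
  | [] => le_rfl
  | k :: ks => by rw [fIdx]; split_ifs <;> simp [fIdx_le_length κ ks]

/-- An occurring key occurs at its first occurrence. [folklore] -/
theorem getElem_fIdx (κ : K) : ∀ (ks : List (Option K)) (h : fIdx κ ks < ks.length), ks[fIdx κ ks] = some κ
  | [], h => by simp [fIdx] at h
  | k :: ks, h => by
    by_cases hk : k = some κ
    · subst hk; simp [fIdx]
    · have h' : fIdx κ ks < ks.length := by rw [fIdx, if_neg hk] at h; simpa using h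
      simp only [fIdx, if_neg hk, List.getElem_cons_succ]
      exact getElem_fIdx κ ks h'

/-- First occurrences of different keys differ (when one of them occurs). [folklore] -/
theorem fIdx_ne_of_ne {κ κ' : K} (ks : List (Option K)) (hne : κ ≠ κ') (h : fIdx κ ks < ks.length) : fIdx κ ks ≠ fIdx κ' ks := by
  intro heq
  have h1 := getElem_fIdx κ ks h
  have h2 := getElem_fIdx κ' ks (heq ▸ h)
  simp only [← heq] at h2
  rw [h1] at h2
  exact hne (Option.some_injective _ h2)

end FIdx

/-! ### The hybrid node interfaces -/

section HybridDefs

variable (P 𝒜)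

/-- The node keys of the supply string. [folklore] -/
noncomputable def pkNW (n : ℕ) (r w : List Bool) : List Bool → List Bool := fun L => pkOf P n (TabW P 𝒜 n r w L)

/-- The node signers of the supply string. [folklore] -/
noncomputable def sgNW (n : ℕ) (r w : List Bool) : List Bool → List Bool → List Bool := fun L m => signOf P n (TabW P 𝒜 n r w L) m

/-- The label of slot `t`. [folklore] -/
def Lslot (n : ℕ) (r : List Bool) (t : ℕ) : List Bool := labAt n (ρD P 𝒜 n r) t

/-- The supply index feeding the label of slot `t`. [folklore] -/
noncomputable def jslot (n : ℕ) (r : List Bool) (t : ℕ) : ℕ :=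
  match (tspec n (P.R.eval n)).key (code n (Lslot P 𝒜 n r t)) with
  | none => 0
  | some κ => fIdx κ (keysD P 𝒜 n r)

/-- The forger's input for the node keys `pkN`. [folklore] -/
def xH (n : ℕ) (r : List Bool) (pkN : List Bool → List Bool) : List Bool := boolPair (xA P n (pkN [])) (rA P 𝒜 n r)

/-- **The hybrid node keys**: the supply keys with the EXTERNAL verification key of the coins `c` planted at slot `t`.
[Goldreich 2004, proof of Prop. 6.4.15, Steps 2–3] [folklore] -/
noncomputable def pkH (n : ℕ) (r w : List Bool) (t : ℕ) (c : List Bool) : List Bool → List Bool :=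
  Function.update (pkNW P 𝒜 n r w) (Lslot P 𝒜 n r t) (P.S.keyGen.run n c).1

/-- The hybrid slot event with the planted node answering the constant `v`, intersected with distinct leaves. [folklore] -/
def GH (n : ℕ) (r w : List Bool) (t : ℕ) (c v : List Bool) : Prop :=
  EVT P 𝒜 n (pkH P 𝒜 n r w t c) (Function.update (sgNW P 𝒜 n r w) (Lslot P 𝒜 n r t) fun _ => v) (ρD P 𝒜 n r) (rA P 𝒜 n r) (Lslot P 𝒜 n r t) ∧
    NoColl n (TA P 𝒜 n) (ρD P 𝒜 n r)

/-- The message the planted node must sign, in the hybrid. [folklore] -/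
noncomputable def mH (n : ℕ) (r w : List Bool) (t : ℕ) (c : List Bool) : List Bool :=
  mStar P 𝒜 n (pkH P 𝒜 n r w t c) (sgNW P 𝒜 n r w) (ρD P 𝒜 n r) (Lslot P 𝒜 n r t) (xH P 𝒜 n r (pkH P 𝒜 n r w t c))

/-- Whether the planted node is used, in the hybrid (against the dummy signer). [folklore] -/
def usedH (n : ℕ) (r w : List Bool) (t : ℕ) (c : List Bool) : Prop :=
  Used (P := P) (𝒜 := 𝒜) n (pkH P 𝒜 n r w t c) (Function.update (sgNW P 𝒜 n r w) (Lslot P 𝒜 n r t) fun _ => []) (ρD P 𝒜 n r) (Lslot P 𝒜 n r t)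
    (xH P 𝒜 n r (pkH P 𝒜 n r w t c))

open scoped Classical in
/-- **The hybrid average at slot `t`** for the external coins `c`: if the planted node is used, the average over the
external signing coins of the exact length of the indicator of the hybrid slot event with the planted node answering
the external signature of `mH`; otherwise the indicator with the empty answer. This is, term by term, the success
integrand of the one-time forger. [Goldreich 2004, proof of Prop. 6.4.15, Steps 2–4] [folklore] -/
noncomputable def hybAvg (n : ℕ) (r w : List Bool) (t : ℕ) (c : List Bool) : ℝ :=
  if usedH P 𝒜 n r w t c then
    uniformAvg (P.S.sign.coinLen (pairCode ((P.S.keyGen.run n c).2, mH P 𝒜 n r w t c)).length) fun ρe =>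
      ind (GH P 𝒜 n r w t c (P.S.sign.run ((P.S.keyGen.run n c).2, mH P 𝒜 n r w t c) ρe))
  else ind (GH P 𝒜 n r w t c [])

end HybridDefs

/-! ### The planted block is one supply block -/

/-- The label of a slot below `NSlot` is a fetched label of length `≤ n`, keyed, fetched at round `t`, and its supply
index is `≤ t`. [folklore] -/
theorem jslot_spec {n : ℕ} (r : List Bool) {t : ℕ} (ht : t < NSlot n (TA P 𝒜 n)) :
    ∃ κ, (tspec n (P.R.eval n)).key (code n (Lslot P 𝒜 n r t)) = some κ ∧ jslot P 𝒜 n r t = fIdx κ (keysD P 𝒜 n r) ∧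
      jslot P 𝒜 n r t ≤ t ∧ t < nFetch P 𝒜 n r := by
  have htn : t < nFetch P 𝒜 n r := lt_of_lt_of_le ht (qD_le_nFetch P 𝒜 n r)
  have hsome := keyAt_isSome (P := P) (𝒜 := 𝒜) (ρD P 𝒜 n r) (j := t) ht
  rw [Option.isSome_iff_exists] at hsome
  obtain ⟨κ, hκ⟩ := hsome
  have hkey : (tspec n (P.R.eval n)).key (code n (Lslot P 𝒜 n r t)) = some κ := hκ
  refine ⟨κ, hkey, by rw [jslot, hkey], ?_, htn⟩
  rw [jslot, hkey]
  refine fIdx_le_of_getElem κ _ t (by rw [keysD, List.length_map, List.length_range]; exact htn) ?_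
  simp only [keysD, List.getElem_map, List.getElem_range]
  exact hκ

/-- The supply index of a slot below `NSlot` is below the supply length `fuelD(n) = nFetch + 1`. [folklore] -/
theorem jslot_lt {n : ℕ} {r : List Bool} (hr : r.length = (cDPoly P 𝒜).eval n) {t : ℕ} (ht : t < NSlot n (TA P 𝒜 n)) :
    jslot P 𝒜 n r t < (fuelD P 𝒜).eval n := by
  obtain ⟨κ, -, -, hle, htn⟩ := jslot_spec (P := P) (𝒜 := 𝒜) r ht
  rw [fuelD_eval P 𝒜 n hr]; omega

/-- **The block of the planted label is its supply block.** [folklore] -/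
theorem TabW_Lslot {n : ℕ} {r : List Bool} (hr : r.length = (cDPoly P 𝒜).eval n) {t : ℕ} (ht : t < NSlot n (TA P 𝒜 n))
    {w : List Bool} (hw : w.length = (fuelD P 𝒜).eval n * P.R.eval n) :
    TabW P 𝒜 n r w (Lslot P 𝒜 n r t) = Yao.blk (P.R.eval n) (jslot P 𝒜 n r t) w := by
  obtain ⟨κ, hkey, hj, -, -⟩ := jslot_spec (P := P) (𝒜 := 𝒜) r ht
  have hjm := jslot_lt (P := P) (𝒜 := 𝒜) hr ht
  rw [TabW, hkey]
  dsimp only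
  rw [← hj, fitLen_of_le (by rw [Yao.length_blk_of_le (by rw [hw]; exact Nat.mul_le_mul_right _ hjm)]),
    List.take_of_length_le (Yao.length_blk_le _ _ _)]

/-- **Overwriting the supply block of the planted label changes no other label's block.** [folklore] -/
theorem TabW_ins_of_ne {n : ℕ} {r : List Bool} (hr : r.length = (cDPoly P 𝒜).eval n) {t : ℕ} (ht : t < NSlot n (TA P 𝒜 n))
    {w x : List Bool} (hw : w.length = (fuelD P 𝒜).eval n * P.R.eval n) (hx : x.length = P.R.eval n) {L : List Bool} (hL : L ≠ Lslot P 𝒜 n r t) :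
    TabW P 𝒜 n r (Yao.ins (P.R.eval n) (jslot P 𝒜 n r t) x w) L = TabW P 𝒜 n r w L := by
  obtain ⟨κ, hkey, hj, hle, htn⟩ := jslot_spec (P := P) (𝒜 := 𝒜) r ht
  have hjm := jslot_lt (P := P) (𝒜 := 𝒜) hr ht
  rw [TabW, TabW]
  cases hk : (tspec n (P.R.eval n)).key (code n L) with
  | none => rfl
  | some κ' =>
    dsimp only
    have hne : κ' ≠ κ := by
      rintro rfl
      apply hL
      apply code_injective n
      have h1 : ∀ q (κ₀ : List.Vector Bool (n + 1)), (tspec n (P.R.eval n)).key q = some κ₀ → q = κ₀.toList := by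
        intro q κ₀ h
        simp only [tspec] at h
        split_ifs at h with hq
        · cases h; rfl
      rw [h1 _ _ hk, h1 _ _ hkey]
    have hidx : fIdx κ' (keysD P 𝒜 n r) ≠ jslot P 𝒜 n r t := by
      rw [hj]
      intro h
      have hlt : fIdx κ (keysD P 𝒜 n r) < (keysD P 𝒜 n r).length := by
        have hlen : (keysD P 𝒜 n r).length = nFetch P 𝒜 n r := by rw [keysD, List.length_map, List.length_range]
        rw [← hj, hlen]; omega
      exact fIdx_ne_of_ne _ hne (h ▸ hlt) h
    have hwj : (jslot P 𝒜 n r t + 1) * P.R.eval n ≤ w.length := by rw [hw]; exact Nat.mul_le_mul_right _ hjm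
    rcases lt_or_gt_of_ne hidx with hlt | hgt
    · rw [Yao.blk_ins_of_lt hwj hlt]
    · rw [Yao.blk_ins_of_gt hx hwj hgt]

/-- Hence the node interfaces, updated at the planted label, do not depend on its supply block. [folklore] -/
theorem update_pkNW_ins {n : ℕ} {r : List Bool} (hr : r.length = (cDPoly P 𝒜).eval n) {t : ℕ} (ht : t < NSlot n (TA P 𝒜 n))
    {w x : List Bool} (hw : w.length = (fuelD P 𝒜).eval n * P.R.eval n) (hx : x.length = P.R.eval n) (pk : List Bool) :
    Function.update (pkNW P 𝒜 n r (Yao.ins (P.R.eval n) (jslot P 𝒜 n r t) x w)) (Lslot P 𝒜 n r t) pk =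
      Function.update (pkNW P 𝒜 n r w) (Lslot P 𝒜 n r t) pk := by
  funext L
  by_cases hL : L = Lslot P 𝒜 n r t
  · subst hL; rw [Function.update_self, Function.update_self]
  · rw [Function.update_of_ne hL, Function.update_of_ne hL, pkNW, pkNW, TabW_ins_of_ne hr ht hw hx hL]

/-- `update_sgNW_ins` (bookkeeping). [folklore] -/
theorem update_sgNW_ins {n : ℕ} {r : List Bool} (hr : r.length = (cDPoly P 𝒜).eval n) {t : ℕ} (ht : t < NSlot n (TA P 𝒜 n))
    {w x : List Bool} (hw : w.length = (fuelD P 𝒜).eval n * P.R.eval n) (hx : x.length = P.R.eval n) (sg : List Bool → List Bool) :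
    Function.update (sgNW P 𝒜 n r (Yao.ins (P.R.eval n) (jslot P 𝒜 n r t) x w)) (Lslot P 𝒜 n r t) sg =
      Function.update (sgNW P 𝒜 n r w) (Lslot P 𝒜 n r t) sg := by
  funext L
  by_cases hL : L = Lslot P 𝒜 n r t
  · subst hL; rw [Function.update_self, Function.update_self]
  · rw [Function.update_of_ne hL, Function.update_of_ne hL]
    funext m
    rw [sgNW, sgNW, TabW_ins_of_ne hr ht hw hx hL]

/-! ### A uniform block is a uniform instance -/

/-- The key of a block `c ‖ u` is the key generated from `c`. [Goldreich 2004, Construction 6.4.16] [folklore] -/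
theorem pkOf_append {n : ℕ} {c : List Bool} (hc : c.length = P.pG.eval n) (u : List Bool) : pkOf P n (c ++ u) = (P.S.keyGen.run n c).1 := by
  rw [pkOf, keyOf, List.take_left' hc]

/-- The signer of a block `c ‖ u` (`|u| = CS(n)`) is the signer of the key of `c` with coins `fitLen u ℓ`.
[Goldreich 2004, Construction 6.4.16] [folklore] -/
theorem signOf_append {n : ℕ} {c u : List Bool} (hc : c.length = P.pG.eval n) (hu : u.length = P.CS.eval n) (m : List Bool) :
    signOf P n (c ++ u) m = P.S.sign.run ((P.S.keyGen.run n c).2, m) (fitLen u (P.pS.eval (pairCode ((P.S.keyGen.run n c).2, m)).length)) := by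
  have hsk : skOf P n (c ++ u) = (P.S.keyGen.run n c).2 := by rw [skOf, keyOf, List.take_left' hc]
  rw [signOf, coinsOf, hsk, List.drop_left' hc, List.take_of_length_le hu.le]

/-! ### The hybrid identity at a slot -/

/-- **The hybrid identity.** Fix the distinguisher's coins `r` and a slot `t < NSlot`. Averaged over a uniform supply
string, the indicator of the slot event of the LAZY attack (all nodes read off the supply), intersected with distinct
leaves, equals the average over the supply and over uniform key-generation coins `c` of the hybrid average `hybAvg`:
the attack with the EXTERNAL key `G(1ⁿ; c)` planted at the slot's label and its (single) signing request answered by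
an external signature with fresh coins of the exact length. [Goldreich 2004, proof of Prop. 6.4.15, Steps 1–4 (the
emulated attack is distributed identically to the real one); Prop. 6.4.17] [cite: Goldreich2004, Prop. 6.4.15] -/
theorem uniformAvg_EVT_eq_hybrid (hcs : P.HCS) (hW : P.WF) {n : ℕ} {r : List Bool} (hr : r.length = (cDPoly P 𝒜).eval n)
    {t : ℕ} (ht : t < NSlot n (TA P 𝒜 n)) :
    uniformAvg ((fuelD P 𝒜).eval n * P.R.eval n) (fun w =>
        ind (EVT P 𝒜 n (pkNW P 𝒜 n r w) (sgNW P 𝒜 n r w) (ρD P 𝒜 n r) (rA P 𝒜 n r) (Lslot P 𝒜 n r t) ∧ NoColl n (TA P 𝒜 n) (ρD P 𝒜 n r))) =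
      uniformAvg ((fuelD P 𝒜).eval n * P.R.eval n) fun w => uniformAvg (P.pG.eval n) fun c => hybAvg P 𝒜 n r w t c := by
  classical
  set m := (fuelD P 𝒜).eval n with hm
  set R := P.R.eval n with hR
  set L := Lslot P 𝒜 n r t with hL
  set j := jslot P 𝒜 n r t with hj
  set ρ := ρD P 𝒜 n r with hρ
  have hjm : j < m := jslot_lt hr ht
  have hρlen : TA P 𝒜 n * n ≤ ρ.length := by rw [hρ, ρD, List.length_drop, hr, cDPoly_eval]; omega
  have hLn : L.length ≤ n := length_labAt_le' (T := TA P 𝒜 n) _ ht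
  -- Ψ: the slot event with the planted block `v`
  set Ψ : List Bool → List Bool → ℝ := fun w v =>
    ind (EVT P 𝒜 n (Function.update (pkNW P 𝒜 n r w) L (pkOf P n v)) (Function.update (sgNW P 𝒜 n r w) L fun msg => signOf P n v msg) ρ (rA P 𝒜 n r) L ∧
      NoColl n (TA P 𝒜 n) ρ) with hΨ
  -- Step 1–2: the lazy event reads the planted block off the supply
  have h1 : uniformAvg (m * R) (fun w => ind (EVT P 𝒜 n (pkNW P 𝒜 n r w) (sgNW P 𝒜 n r w) ρ (rA P 𝒜 n r) L ∧ NoColl n (TA P 𝒜 n) ρ)) =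
      uniformAvg (m * R) (fun w => Ψ w (Yao.blk R j w)) := by
    refine SigOWF.uniformAvg_congr' fun w hw => ?_
    rw [hΨ]
    dsimp only
    rw [← TabW_Lslot hr ht hw]
    have hpk : Function.update (pkNW P 𝒜 n r w) L (pkOf P n (TabW P 𝒜 n r w L)) = pkNW P 𝒜 n r w := Function.update_eq_self L _
    have hsg : Function.update (sgNW P 𝒜 n r w) L (fun msg => signOf P n (TabW P 𝒜 n r w L) msg) = sgNW P 𝒜 n r w := Function.update_eq_self L _
    rw [hpk, hsg]
  -- Step 3: re-randomise the planted block
  have h2 : uniformAvg (m * R) (fun w => Ψ w (Yao.blk R j w)) = uniformAvg (m * R) fun w => uniformAvg R fun v => Ψ w v := by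
    refine uniformAvg_rerand hjm Ψ fun w x v hw hx => ?_
    rw [hΨ]
    dsimp only
    rw [update_pkNW_ins hr ht hw hx, update_sgNW_ins hr ht hw hx]
  rw [h1, h2]
  refine SigOWF.uniformAvg_congr' fun w hw => ?_
  -- Step 4: a uniform block is uniform key-generation coins and uniform signing-coin material
  have hRsplit : R = P.pG.eval n + P.CS.eval n := by rw [hR, Spec.R, eval_add]
  rw [hRsplit, uniformAvg_append']
  refine SigOWF.uniformAvg_congr' fun c hc => ?_
  -- for fixed `c`: the planted key is the external key; the planted signer uses coins `fitLen u ℓ`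
  have hpkH : ∀ u : List Bool, Function.update (pkNW P 𝒜 n r w) L (pkOf P n (c ++ u)) = pkH P 𝒜 n r w t c := by
    intro u; rw [pkOf_append hc, pkH]
  set sgU : List Bool → List Bool → List Bool := fun u msg =>
    P.S.sign.run ((P.S.keyGen.run n c).2, msg) (fitLen u (P.pS.eval (pairCode ((P.S.keyGen.run n c).2, msg)).length)) with hsgU
  have hΨc : ∀ u : List Bool, u.length = P.CS.eval n → Ψ w (c ++ u) = ind (GH P 𝒜 n r w t c (sgU u (mH P 𝒜 n r w t c))) := by
    intro u hu
    rw [hΨ]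
    dsimp only
    rw [hpkH u]
    have hsg : (fun msg => signOf P n (c ++ u) msg) = sgU u := by funext msg; rw [signOf_append hc hu]
    rw [hsg, GH]
    -- single use (inside the `NoColl` indicator)
    by_cases hnc : NoColl n (TA P 𝒜 n) ρ
    · have hcase : L.length < n ∨ (L.length = n ∧ NoColl n (TA P 𝒜 n) ρ) := by
        rcases Nat.lt_or_ge L.length n with h | h
        · exact Or.inl h
        · exact Or.inr ⟨le_antisymm hLn h, hnc⟩
      have hru := run_update_eq (P := P) (𝒜 := 𝒜) (pkH P 𝒜 n r w t c) (sgNW P 𝒜 n r w) ρ hcase hρlen (sgU u) (xH P 𝒜 n r (pkH P 𝒜 n r w t c))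
      refine ind_congr (and_congr_left fun _ => ?_)
      rw [mH]
      exact EVT_congr _ hru.1 hru.2 L
    · rw [ind_and_of_left hnc, ind_and_of_left hnc]
  rw [SigOWF.uniformAvg_congr' hΨc]
  -- Step 5: the coin identity, then the used/unused split
  rw [hsgU]
  dsimp only
  rw [uniformAvg_sign_fitLen hcs hW hc (mH P 𝒜 n r w t c) fun v => ind (GH P 𝒜 n r w t c v), hybAvg]
  split_ifs with hused
  · rfl
  · -- unused: the event does not depend on the planted answer
    have hconst : ∀ v, ind (GH P 𝒜 n r w t c v) = ind (GH P 𝒜 n r w t c []) := by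
      intro v
      refine ind_congr (and_congr_left fun _ => ?_)
      have hru := run_update_eq_of_not_used (P := P) (𝒜 := 𝒜) (pkH P 𝒜 n r w t c) (sgNW P 𝒜 n r w) ρ (fun _ => []) (fun _ => v)
        (xH P 𝒜 n r (pkH P 𝒜 n r w t c)) hused
      exact (EVT_congr _ hru.1 hru.2 L).symm
    simp_rw [hconst]
    exact SigOWF.uniformAvg_const' _ _

/-! ### Linear bookkeeping of uniform averages -/

/-- Uniform averages are additive. [folklore] -/
theorem uniformAvg_add_fun (m : ℕ) (f g : List Bool → ℝ) : uniformAvg m (fun x => f x + g x) = uniformAvg m f + uniformAvg m g := by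
  unfold uniformAvg
  rw [← add_div, Finset.sum_add_distrib]

/-- Uniform averages commute with finite sums. [folklore] -/
theorem uniformAvg_finset_sum {ι : Type} (s : Finset ι) (m : ℕ) (f : ι → List Bool → ℝ) :
    uniformAvg m (fun x => ∑ i ∈ s, f i x) = ∑ i ∈ s, uniformAvg m (f i) := by
  unfold uniformAvg
  rw [Finset.sum_comm, Finset.sum_div]

/-- A function of the suffix: the prefix averages out. [folklore] -/
theorem uniformAvg_drop' (a b : ℕ) (f : List Bool → ℝ) : uniformAvg (a + b) (fun r => f (r.drop a)) = uniformAvg b f := by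
  have h := SigOWF.uniformAvg_add' a b (fun _ w => f w)
  rw [SigOWF.uniformAvg_const'] at h
  exact h

/-! ### The ideal game is bounded by collisions plus the hybrid averages -/

/-- `¬ NoColl` is a collision among the first `T` leaves. [folklore] -/
theorem not_noColl_iff (n T : ℕ) (ρ : List Bool) : ¬ NoColl n T ρ ↔ ∃ i j, i < j ∧ j < T ∧ Yao.blk n i ρ = Yao.blk n j ρ := by
  unfold NoColl
  push Not
  rfl

/-- **Distinct leaves fail rarely**: averaged over the distinguisher's coins, the leaves of the `TA` queries collide with
probability at most `TA² / 2ⁿ`. [Goldreich 2004, proof of Prop. 6.4.17 (birthday bound for the uniformly selected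
leaves)] [cite: Goldreich2004, Prop. 6.4.17] -/
theorem uniformAvg_not_noColl_le (n : ℕ) :
    uniformAvg ((cDPoly P 𝒜).eval n) (fun r => ind (¬ NoColl n (TA P 𝒜 n) (ρD P 𝒜 n r))) ≤ (TA P 𝒜 n : ℝ) ^ 2 / 2 ^ n := by
  classical
  rw [cDPoly_eval]
  have h : uniformAvg (cA P 𝒜 n + TA P 𝒜 n * n) (fun r => ind (¬ NoColl n (TA P 𝒜 n) (ρD P 𝒜 n r))) =
      uniformAvg (TA P 𝒜 n * n) (fun ρ => if ∃ i j, i < j ∧ j < TA P 𝒜 n ∧ Yao.blk n i ρ = Yao.blk n j ρ then (1 : ℝ) else 0) := by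
    rw [← uniformAvg_drop' (cA P 𝒜 n) (TA P 𝒜 n * n)]
    refine SigOWF.uniformAvg_congr' fun r _ => ?_
    rw [ρD, ind_congr (not_noColl_iff n _ _), ind_eq_ite]
  rw [h]
  exact uniformAvg_exists_blk_collision_le_sq n (TA P 𝒜 n)

/-- The forgery indicator is bounded by the collision indicator plus the slot events with distinct leaves. [folklore] -/
theorem ind_forgeWith_le {n : ℕ} (pkN : List Bool → List Bool) (sgN : List Bool → List Bool → List Bool) {ρ : List Bool}
    (hρ : TA P 𝒜 n * n ≤ ρ.length) (rA : List Bool) :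
    ind (ForgeWith P 𝒜 n (pkN []) (OFunI n pkN sgN ρ) rA) ≤
      ind (¬ NoColl n (TA P 𝒜 n) ρ) + ∑ t ∈ Finset.range (NSlot n (TA P 𝒜 n)), ind (EVT P 𝒜 n pkN sgN ρ rA (labAt n ρ t) ∧ NoColl n (TA P 𝒜 n) ρ) := by
  classical
  by_cases hnc : NoColl n (TA P 𝒜 n) ρ
  · have h := indicator_forgeWith_le_sum pkN sgN hρ rA
    rw [← ind_eq_ite] at h
    refine h.trans ?_
    rw [ind_false (not_not_intro hnc), zero_add]
    refine Finset.sum_le_sum fun t _ => le_of_eq ?_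
    rw [← ind_eq_ite]
    exact ind_congr ⟨fun h => ⟨h, hnc⟩, fun h => h.1⟩
  · rw [ind_true hnc]
    have h0 : 0 ≤ ∑ t ∈ Finset.range (NSlot n (TA P 𝒜 n)), ind (EVT P 𝒜 n pkN sgN ρ rA (labAt n ρ t) ∧ NoColl n (TA P 𝒜 n) ρ) :=
      Finset.sum_nonneg fun t _ => ind_nonneg _
    linarith [ind_le_one (ForgeWith P 𝒜 n (pkN []) (OFunI n pkN sgN ρ) rA)]

/-- **The ideal PRF game of the distinguisher is bounded by collisions plus the hybrid averages.** The point of the whole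
lazy/hybrid analysis: the right-hand side is, slot by slot, the success probability of the one-time forger.
[Goldreich 2004, proofs of Prop. 6.4.15 (Steps 1–4) and Prop. 6.4.17] [cite: Goldreich2004, Prop. 6.4.17] -/
theorem prfIdealProb_le_hybrid (hcs : P.HCS) (hW : P.WF) {B : Bounds} (hB : B.OK P 𝒜) (n : ℕ) :
    prfIdealProb (fun m => m + 1) (fun m => P.R.eval m) (distinguisher P 𝒜 B.PcOf (B.cOf P 𝒜) (Bounds.ROf P 𝒜)) n ≤
      (TA P 𝒜 n : ℝ) ^ 2 / 2 ^ n +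
        ∑ t ∈ Finset.range (NSlot n (TA P 𝒜 n)), uniformAvg ((cDPoly P 𝒜).eval n) fun r =>
          uniformAvg ((fuelD P 𝒜).eval n * P.R.eval n) fun w => uniformAvg (P.pG.eval n) fun c => hybAvg P 𝒜 n r w t c := by
  classical
  rw [prfIdealProb_distinguisher_TabL hW hB n]
  -- over supply strings, as the forgery event against the node interfaces of the string
  have hstep : ∀ r : List Bool, r.length = (cDPoly P 𝒜).eval n →
      supplyProb (fun s : Fin ((fuelD P 𝒜).eval n) → List.Vector Bool (P.R.eval n) =>
          ForgeWith P 𝒜 n (pkOf P n (TabL P 𝒜 n r (List.ofFn s) [])) (OFun P n (TabL P 𝒜 n r (List.ofFn s)) (ρD P 𝒜 n r)) (rA P 𝒜 n r)) ≤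
        ind (¬ NoColl n (TA P 𝒜 n) (ρD P 𝒜 n r)) +
          ∑ t ∈ Finset.range (NSlot n (TA P 𝒜 n)), uniformAvg ((fuelD P 𝒜).eval n * P.R.eval n) fun w =>
            uniformAvg (P.pG.eval n) fun c => hybAvg P 𝒜 n r w t c := by
    intro r hr
    have hρ : TA P 𝒜 n * n ≤ (ρD P 𝒜 n r).length := by rw [ρD, List.length_drop, hr, cDPoly_eval]; omega
    rw [supplyProb_eq_uniformAvg]
    have hcongr : uniformAvg ((fuelD P 𝒜).eval n * P.R.eval n) (fun w => if ForgeWith P 𝒜 n (pkOf P n (TabL P 𝒜 n r (List.ofFn (vblocks (P.R.eval n) ((fuelD P 𝒜).eval n) w)) []))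
          (OFun P n (TabL P 𝒜 n r (List.ofFn (vblocks (P.R.eval n) ((fuelD P 𝒜).eval n) w))) (ρD P 𝒜 n r)) (rA P 𝒜 n r) then (1 : ℝ) else 0) =
        uniformAvg ((fuelD P 𝒜).eval n * P.R.eval n) (fun w =>
          ind (ForgeWith P 𝒜 n (pkNW P 𝒜 n r w []) (OFunI n (pkNW P 𝒜 n r w) (sgNW P 𝒜 n r w) (ρD P 𝒜 n r)) (rA P 𝒜 n r))) := by
      refine SigOWF.uniformAvg_congr' fun w hw => ?_
      rw [← ind_eq_ite, TabL_ofFn_vblocks n _ r w hw]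
      rfl
    rw [hcongr]
    refine (SigOWF.uniformAvg_mono fun w _ => ind_forgeWith_le (pkNW P 𝒜 n r w) (sgNW P 𝒜 n r w) hρ (rA P 𝒜 n r)).trans ?_
    rw [uniformAvg_add_fun, SigOWF.uniformAvg_const', uniformAvg_finset_sum]
    refine add_le_add le_rfl (Finset.sum_le_sum fun t ht => le_of_eq ?_)
    exact uniformAvg_EVT_eq_hybrid hcs hW hr (Finset.mem_range.1 ht)
  refine (SigOWF.uniformAvg_mono hstep).trans ?_
  rw [uniformAvg_add_fun, uniformAvg_finset_sum]
  exact add_le_add (uniformAvg_not_noColl_le (P := P) (𝒜 := 𝒜) n) le_rfl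

end TreeSig

end Literature.Computability.Cryptography
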